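import Literature.NumberTheory.GaloisRepresentations.SerreTrickTwistCharRat
import Literature.NumberTheory.GaloisRepresentations.TameCharacterInertiaOrder
import Literature.NumberTheory.GaloisRepresentations.GaloisRepUnramifiedProofs
import HarnessLib

/-!
# Allen's Artin lift `ρ₁` over `ℚ` is unramified at `2` when `2` is unramified in `L`

Topic `Literature/NumberTheory/GaloisRepresentations`; namespace
`Literature.NumberTheory.GaloisRepresentations`.  A theorems-only file (no definition, no named
fact; D-0026) on the odd monomial Artin lift `ρ₁ = Ind_{G_L}^{G_ℚ} (χ ξ)` of a mod-`2` dihedral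
`ρ̄` produced by `FramedGaloisRep.exists_odd_monomial_artinLift_diagonal_oddOrder_*`
(`SerreTrickTwistCharRat`; Allen 2014, Lemma 87, arXiv:1301.1113v2 pp. 69–70): locally at the
place `v ∣ 2`, `P⁻¹ ρ₁|_{Γ_{ℚ_v}} P = diag(χ'_v, χ_v)` with `χ'_v, χ_v` continuous of finite order,
and of ODD order on `res⁻¹(G_L)` (there `ξ = 1` and `ρ₁` is the Teichmüller lift, whose entries are
odd-order roots of unity).

* `FramedGaloisRep.isUnramifiedAt_of_forall_toLocal_eq_one` — the local criterion for framed
  representations: `ρ|_{Γ_{K_v}}` trivial on `I_{K_v}` ⟹ `ρ` unramified at `v` (the tree's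
  `GaloisRep.isUnramifiedAt_iff_toLocal_holds` through `isUnramifiedAt_toGaloisRep_iff`).
* `isOpen_ker_toHomUnits_of_pow_eq_one` — a continuous character with values in the `N`-th roots
  of unity of a topological field has open kernel (its fibres are the complements of finitely many
  closed fibres).
* `FramedGaloisRep.isUnramifiedAt_of_diagonal_of_odd_two` — **the dyadic accident**: if at
  `v ∣ 2` a framed `ρ₁ : Γ_ℚ → GL₂(ℚ̄₂)` is conjugate on `Γ_{ℚ_v}` to `diag(χ₁, χ₂)` with `χᵢ`
  continuous, of finite order, and of ODD order on the inertia group `I_{ℚ_v}`, then `ρ₁` is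
  UNRAMIFIED at `v`: odd-order abelian characters of `Γ_{ℚ₂}` are unramified
  (`adicCompletion_rat_eq_one_of_mem_absInertia_of_odd`: the abelianised inertia `ℤ₂ˣ = 1 + 2ℤ₂`
  is pro-`2`).
* `FramedGaloisRep.exists_odd_monomial_artinLift_unramified_of_isOrdinaryOfWeightAt_two_rat` —
  consequently, from hypotheses (2) and (4) of Allen's Introduction Theorem over `ℚ` at `v ∣ 2`:
  IF the inertia group of `ℚ_v` lands in the index-two subgroup `Hm = G_L` cut out by `ρ̄`
  ("`2` unramified in `L`"), the odd monomial Artin lift `ρ₁` of `ρ̄` is unramified at `v` — so its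
  weight-one newform has level prime to `2` (Deligne–Serre 4.6 (a), the tree's
  `artinConductorNat_eq_level_holds`) and is `2`-ordinary for free (its Hecke polynomial at `2`
  is the characteristic polynomial of a finite-order Frobenius), the case of Lemma 87 in which no
  `v`-stabilisation twist is needed.

## References

* P. B. Allen, Compositio Math. 150 (2014) = arXiv:1301.1113v2, §5.1.1, Lemma 87, p. 70. [Allen2014]
* J.-P. Serre, *Local Fields* (1979), XIV §7 Thm. 2; J. Neukirch, *ANT*, II (9.6). [SerreLocalFields1979]
-/

noncomputable section

open scoped MatrixGroups NumberField
open Field IsDedekindDomain Polynomial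

namespace Literature.NumberTheory.GaloisRepresentations

/-! ### Local criterion for framed representations -/

section Local

variable {K : Type*} [Field K] [NumberField K] {A : Type*} [CommRing A] [TopologicalSpace A]
  [IsTopologicalRing A] {n : ℕ}

/-- **`ρ|_{Γ_{K_v}}` trivial on inertia ⟹ `ρ` unramified at `v`** (framed form of the tree's
`GaloisRep.isUnramifiedAt_iff_toLocal_holds`; Neukirch II (9.6)). [cite: NeukirchANT1999, Ch. II §9 Prop. (9.6)] -/
theorem FramedGaloisRep.isUnramifiedAt_of_forall_toLocal_eq_one (v : HeightOneSpectrum (𝓞 K))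
    (ρ : FramedGaloisRep K A n)
    (h : ∀ σ ∈ absInertia (v.adicCompletion K), ρ.toLocal v σ = 1) : ρ.IsUnramifiedAt v := by
  rw [← FramedGaloisRep.isUnramifiedAt_toGaloisRep_iff]
  refine (GaloisRep.isUnramifiedAt_iff_toLocal_holds v ρ.toGaloisRep).2 fun σ hσ => ?_
  have h1 : ρ (absGaloisRestrict K (v.adicCompletion K) σ) = 1 := by
    rw [← FramedGaloisRep.toLocal_apply]; exact h σ hσ
  rw [GaloisRep.toLocal_apply]
  change FramedRep.toRepresentation ρ (absGaloisRestrict K (v.adicCompletion K) σ) = 1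
  refine LinearMap.ext fun w => ?_
  simp [h1]

end Local

/-! ### Open kernel of a root-of-unity-valued continuous character -/

section OpenKer

variable {G : Type*} [Group G] [TopologicalSpace G] {F : Type*} [Field F] [TopologicalSpace F]
  [T1Space F]

/-- A continuous homomorphism `χ : G → F` into a topological field with values in the `N`-th roots
of unity (`N > 0`) has open kernel: the kernel is the complement of the preimage of the finite,
hence closed, set of `N`-th roots of unity other than `1`. [folklore] -/
theorem isOpen_ker_toHomUnits_of_pow_eq_one {O : Type*} [SetLike O F] [SubringClass O F]
    {S : O} (χ : G →* S) {N : ℕ} (hN : 0 < N) (hpow : ∀ g, (χ g : F) ^ N = 1)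
    (hcont : Continuous fun g => (χ g : F)) :
    IsOpen ((((SubringClass.subtype S).toMonoidHom.comp χ).toHomUnits.ker : Subgroup G) :
      Set G) := by
  classical
  have hker : ((((SubringClass.subtype S).toMonoidHom.comp χ).toHomUnits.ker : Subgroup G) :
      Set G) = (fun g => (χ g : F)) ⁻¹' {1} := by
    ext g
    rw [SetLike.mem_coe, MonoidHom.mem_ker, Set.mem_preimage, Set.mem_singleton_iff, ← Units.val_inj,
      MonoidHom.coe_toHomUnits, Units.val_one]
    rfl
  rw [hker, ← isClosed_compl_iff]
  have hcompl : ((fun g => (χ g : F)) ⁻¹' {1})ᶜ =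
      (fun g => (χ g : F)) ⁻¹' (((nthRoots N (1 : F)).toFinset : Set F) \ {1}) := by
    ext g
    simp only [Set.mem_compl_iff, Set.mem_preimage, Set.mem_singleton_iff, Set.mem_sdiff,
      Finset.mem_coe, Multiset.mem_toFinset, mem_nthRoots hN, hpow g, true_and]
  rw [hcompl]
  exact (((nthRoots N (1 : F)).toFinset.finite_toSet.sdiff).isClosed).preimage hcont

end OpenKer

/-! ### The dyadic accident -/

section Dyadic

/-- **At `v ∣ 2`: conjugate to `diag(χ₁, χ₂)` on `Γ_{ℚ_v}` with `χᵢ` continuous of finite order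
and of ODD order on inertia ⟹ unramified at `v`.** [cite: Allen2014, Lemma 87 (p. 70)]
[cite: SerreLocalFields1979, Ch. XIV §7 Thm. 2] -/
theorem FramedGaloisRep.isUnramifiedAt_of_diagonal_of_odd_two (v : HeightOneSpectrum (𝓞 ℚ))
    (hv : (Rat.HeightOneSpectrum.primesEquiv v : ℕ) = 2) (ρ₁ : FramedGaloisRep ℚ (PadicAlgCl 2) 2)
    (P : GL (Fin 2) (PadicAlgCl 2))
    (χ₁ χ₂ : absoluteGaloisGroup (v.adicCompletion ℚ) →* padicAlgClIntegers 2) {N n₀ : ℕ}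
    (hN : 0 < N)
    (hdiag : ∀ σ, (P⁻¹ * ρ₁.toLocal v σ * P).val =
      Matrix.diagonal ![(χ₁ σ : PadicAlgCl 2), (χ₂ σ : PadicAlgCl 2)])
    (hpow : ∀ σ, (χ₁ σ : PadicAlgCl 2) ^ N = 1 ∧ (χ₂ σ : PadicAlgCl 2) ^ N = 1)
    (hcont₁ : Continuous fun σ => (χ₁ σ : PadicAlgCl 2))
    (hcont₂ : Continuous fun σ => (χ₂ σ : PadicAlgCl 2)) (hodd : Odd n₀)
    (hn₀ : ∀ σ ∈ absInertia (v.adicCompletion ℚ),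
      (χ₁ σ : PadicAlgCl 2) ^ n₀ = 1 ∧ (χ₂ σ : PadicAlgCl 2) ^ n₀ = 1) :
    ρ₁.IsUnramifiedAt v := by
  haveI : Fact (Nat.Prime 2) := ⟨Nat.prime_two⟩
  -- the two characters as homomorphisms into `ℚ̄₂ˣ`
  let Λ : (absoluteGaloisGroup (v.adicCompletion ℚ) →* padicAlgClIntegers 2) →
      (absoluteGaloisGroup (v.adicCompletion ℚ) →* (PadicAlgCl 2)ˣ) :=
    fun χ => (((padicAlgClIntegers 2).subtype).toMonoidHom.comp χ).toHomUnits
  have hΛ : ∀ χ σ, (Λ χ σ : PadicAlgCl 2) = (χ σ : PadicAlgCl 2) := fun χ σ => rfl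
  have htriv : ∀ (χ : absoluteGaloisGroup (v.adicCompletion ℚ) →* padicAlgClIntegers 2),
      (∀ σ, (χ σ : PadicAlgCl 2) ^ N = 1) → Continuous (fun σ => (χ σ : PadicAlgCl 2)) →
      (∀ σ ∈ absInertia (v.adicCompletion ℚ), (χ σ : PadicAlgCl 2) ^ n₀ = 1) →
      ∀ σ ∈ absInertia (v.adicCompletion ℚ), (χ σ : PadicAlgCl 2) = 1 := by
    intro χ hχN hχc hχodd σ hσ
    have hopen : IsOpen (((Λ χ).ker : Subgroup _) : Set (absoluteGaloisGroup (v.adicCompletion ℚ))) :=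
      isOpen_ker_toHomUnits_of_pow_eq_one (F := PadicAlgCl 2) χ hN hχN hχc
    have h1 := adicCompletion_rat_eq_one_of_mem_absInertia_of_odd v hv (Λ χ) hopen
      (fun a b => mul_comm _ _) hodd (fun τ hτ => Units.ext (by
        rw [Units.val_pow_eq_pow_val, hΛ, Units.val_one]; exact hχodd τ hτ)) σ hσ
    rw [← hΛ, h1, Units.val_one]
  have h₁ := htriv χ₁ (fun σ => (hpow σ).1) hcont₁ (fun σ hσ => (hn₀ σ hσ).1)
  have h₂ := htriv χ₂ (fun σ => (hpow σ).2) hcont₂ (fun σ hσ => (hn₀ σ hσ).2)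
  refine ρ₁.isUnramifiedAt_of_forall_toLocal_eq_one v fun σ hσ => ?_
  have hval : (P⁻¹ * ρ₁.toLocal v σ * P).val = 1 := by
    rw [hdiag σ, h₁ σ hσ, h₂ σ hσ]
    ext i j
    fin_cases i <;> fin_cases j <;> simp [Matrix.diagonal]
  have hone : P⁻¹ * ρ₁.toLocal v σ * P = 1 := Units.ext hval
  calc ρ₁.toLocal v σ = P * (P⁻¹ * ρ₁.toLocal v σ * P) * P⁻¹ := by group
    _ = 1 := by rw [hone, mul_one, mul_inv_cancel]

/-- **Allen's Lemma 87 over `ℚ` at `v ∣ 2`, the unramified case: if the inertia group of `ℚ_v`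
lands in `G_L`, the odd monomial Artin lift `ρ₁` of `ρ̄` is unramified at `v`.**  From hypotheses
(2) (ordinary of some weight at `v`) and (4) (residually absolutely irreducible with solvable
residual image) of the Introduction Theorem over `ℚ`: the lift of
`FramedGaloisRep.exists_odd_monomial_artinLift_diagonal_oddOrder_of_isOrdinaryOfWeightAt_two_rat`
(continuous, open kernel, integral monomial model w.r.t. the open index-two `Hm ⊇ ker ρ̄`, odd,
a lift of `ρ̄`), which is moreover UNRAMIFIED at `v` as soon as `res(I_{ℚ_v}) ⊆ Hm`.
[cite: Allen2014, Lemma 87 (arXiv:1301.1113v2, §5.1.1, pp. 69–70)] -/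
theorem FramedGaloisRep.exists_odd_monomial_artinLift_unramified_of_isOrdinaryOfWeightAt_two_rat
    (ρ : FramedGaloisRep ℚ (PadicAlgCl 2) 2) (hres : ρ.IsResiduallyAbsIrreducible)
    (hsol : IsSolvable ρ.residualRep.range) (v : HeightOneSpectrum (𝓞 ℚ))
    (hv : (Rat.HeightOneSpectrum.primesEquiv v : ℕ) = 2) {k m : ℕ}
    (hord : FramedGaloisRep.IsOrdinaryOfWeightAt 2 ρ v k m) :
    ∃ (ρ₁ : FramedGaloisRep ℚ (PadicAlgCl 2) 2)
      (ρ₀' : absoluteGaloisGroup ℚ →* GL (Fin 2) (padicAlgClIntegers 2))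
      (Hm : Subgroup (absoluteGaloisGroup ℚ)),
      (∀ σ, Matrix.GeneralLinearGroup.map (padicAlgClIntegers 2).subtype (ρ₀' σ) = ρ₁ σ) ∧
      IsOpen ((ρ₁ : absoluteGaloisGroup ℚ →* GL (Fin 2) (PadicAlgCl 2)).ker :
        Set (absoluteGaloisGroup ℚ)) ∧
      ρ₁.IsReductionOf (RingHom.id _) ρ.residualRep ∧ ρ₁.IsOdd ∧
      IsOpen (Hm : Set (absoluteGaloisGroup ℚ)) ∧ Hm.index = 2 ∧ ρ.residualRep.ker ≤ Hm ∧
      (∀ h ∈ Hm, (ρ₀' h).val 0 1 = 0 ∧ (ρ₀' h).val 1 0 = 0) ∧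
      (∀ g ∉ Hm, (ρ₀' g).val 0 0 = 0 ∧ (ρ₀' g).val 1 1 = 0) ∧
      ((∀ σ ∈ absInertia (v.adicCompletion ℚ), absGaloisRestrict ℚ (v.adicCompletion ℚ) σ ∈ Hm) →
        ρ₁.IsUnramifiedAt v) := by
  obtain ⟨ρ₁, ρ₀', Hm, N, hN, hmap, hopen, hred, -, hodd, hHo, hHi, hHk, hdg, had, Q, P, χ₁, χ₂,
    -, hdiag, hpow, ⟨n₀, -, hn₀2, hn₀⟩, -, hc₁, hc₂⟩ :=
    ρ.exists_odd_monomial_artinLift_diagonal_oddOrder_of_isOrdinaryOfWeightAt_two_rat hres hsol v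
      hord
  refine ⟨ρ₁, ρ₀', Hm, hmap, hopen, hred, hodd, hHo, hHi, hHk, hdg, had, fun hI => ?_⟩
  have hodd' : Odd n₀ := Nat.odd_iff.2 (Nat.two_dvd_ne_zero.1 hn₀2)
  exact ρ₁.isUnramifiedAt_of_diagonal_of_odd_two v hv P χ₁ χ₂ (Nat.mul_pos two_pos hN) hdiag hpow
    hc₁ hc₂ hodd' fun σ hσ => hn₀ σ (hI σ hσ)

end Dyadic

end Literature.NumberTheory.GaloisRepresentations

end
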